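/-
Copyright: derived here (Resolution Observatory cell `pub-rosobs`, carver gen 64). AI-written Lean; AI review is weaker than expert
review.  Companion file of the cell's POLYNOMIAL weighted-centre model `W(f)`: the one-parameter family of substitutions
`Ψ_τ : g ↦ (T g)(σ := τ)` generated by the `σ`-truncated exponential `T = sigmaExp D p u` of a derivation `D` of `k[ε]`
(`WeightedCentreTruncatedExponential`), its GROUP LAW MODULO `σ^p` and its behaviour under `σ ↦ cσ` — the abstract core of
engine 1's "truncated group `𝔄₁/𝔄_p`" step (RE-DERIVATION-eng1-g43 §3.12 (B); CARVER-NOTES-eng1-g43 T107, case `r = 1`).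
Instrument — NOT a resolution theorem and NOT a statement about the invariant of [AbramovichTemkinWlodarczyk2024].
-/
import Literature.AlgebraicGeometry.Resolution.WeightedCentreTruncatedExponential
import Literature.AlgebraicGeometry.Resolution.WeightedCentreSigmaRescaling
import HarnessLib

/-!
# The truncated exponential flow `Ψ_τ` of a derivation: group law modulo `σ^p`

Uniform value line: INSTRUMENT — kernel-checked bookkeeping for the polynomial weighted-centre model `W(f)` of the cell
(engine 1's toy model) — NOT a resolution theorem, NOT a statement about the Abramovich–Temkin–Włodarczyk invariant, NOT summit
progress; AI-written Lean, AI review is weaker than expert review.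

Setting (as in `WeightedCentreTruncatedExponential`): `R` a commutative ring, `A = MvPolynomial ι R = R[ε]`,
`D : Derivation R A A` (no nilpotency, no characteristic hypothesis), a cut-off `p : ℕ` and inverse factorials `u` below `p`
(`k! · u k = 1` for `k < p`), `T = sigmaExp D p u : A →ₐ[R] A[σ]`, `T(ε_i) = Σ_{k<p} u_k D^[k](ε_i) σ^k`.
For a PARAMETER `τ ∈ R[σ]` with scalar coefficients (typically `τ = c·σ`; in the comments of this file `⟪τ⟫` denotes
`τ.map C ∈ A[σ]`, `C : R → A`):

* `flowC D p u τ : A →ₐ[R] A[σ]`, `g ↦ (T g)(σ := τ)`, and the substitution `flow D p u τ : A[σ] →+* A[σ]`, `σ ↦ σ`,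
  `C g ↦ flowC τ g` — the cell's `Ψ_τ = exp_{<p}(τ·𝔇)`.  Exactly: `flowC σ = T` (`flowC_X_eq`), `flow 0 = id` (`flow_zero`),
  `flow τ` fixes `R[σ]` (`flow_map`), for `τ = aσ` the `σ^n`-coefficient of `flow (aσ) (C g)` is `aⁿ u_n D^[n] g` for `n < p`
  (`coeff_flowC_C_mul_X_of_lt`), and `σ ↦ cσ` acts on the parameter: `rescaleHom (C c) (flow τ) = flow (τ(cσ))`
  (`rescaleHom_flow`; `flow (aσ) ↦ flow ((a c) σ)`);
* **truncation** (`X_pow_dvd_flowC_sub`): if `σ ∣ τ` then `flowC τ g ≡ Σ_{n<p} u_n D^[n](g) ⟪τ⟫ⁿ (mod σ^p)` for EVERY `g ∈ A`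
  ((S2) of the companion file read through `σ ↦ τ`); hence `flow τ ≡ id (mod σ^m)` whenever `σ^m ∣ τ`, `m ≤ p`
  (`X_pow_dvd_flow_sub_self`) — `flow τ` lies in the congruence subgroup of level `m`;
* **group law modulo `σ^p`** (`X_pow_dvd_flow_flow_sub`): for `σ ∣ τ₁, τ₂` and every `y ∈ A[σ]`,
  `flow τ₁ (flow τ₂ y) ≡ flow (τ₁ + τ₂) y (mod σ^p)` — the binomial theorem plus `u_{j+k} · C(j+k, j) = u_j u_k` below `p`
  (`inv_factorial_mul_choose`); the terms with `j + k ≥ p` are the whole discrepancy and they are `O(σ^p)`.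
  Corollaries: `flow (−τ)` inverts `flow τ` modulo `σ^p` (`X_pow_dvd_flow_neg_flow_sub`), the `N`-th power of `flow τ` is
  `flow (N•τ)` modulo `σ^p` (`X_pow_dvd_flow_pow_sub`), and for `τ = σ` the RESCALED flow `(flow σ)_{Nσ}` is the `N`-th power
  modulo `σ^p` (`X_pow_dvd_rescaleHom_flow_sub_pow` — the identity "`s_N Ψ ≡ Ψ^N`" of the cell's truncated group);
* **two substitutions agreeing on `σ`, on the scalars and, modulo `σ^m`, on the generators `ε_i` agree modulo `σ^m`**
  (`X_pow_dvd_sub_of_forall_X`, the congruence bookkeeping used throughout);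
* **grading** (`isGradedHom_flow`): if `D` lowers `w`-weights by `θ` and `⟪τ⟫` has total weight `θ` (for `deg σ = ρ`), then
  `flow τ` is GRADED (`IsGradedHom w ρ`).

Dictionary with [Matsumura1987, §27 (pp. 207–209)]: `(u_k D^[k])_{k<p}` is the ITERATIVE HIGHER DERIVATION of length `p − 1`
generated by `D` (there `D_i = D_1^i / i!`, `i < p`), `g ↦ Σ_{k<p} u_k D^[k] g · t^k` is the associated ring homomorphism
`E_t : A → A[t]/(t^p)`, and iterativity `D_i ∘ D_j = C(i+j, i) · D_{i+j}` is equivalent to the group law `E_{t+t'} = E_{t'} ∘ E_t`;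
the statements below are this classical fact in the polynomial model, written as divisibilities by `σ^p` inside `A[σ]` (no quotient
ring is formed).  The `mod σ^m` calculus of substitutions follows [SerreLocalFields1979, Ch. II §4 Lemma 1] as in the companion
files; weighted gradings as in [AbramovichTemkinWlodarczyk2024, Thm. 5.3.1] — CONTEXT ONLY; formalisation and packaging ours,
elementary.  What is NOT here: the groups `𝔄_m` themselves (`WeightedCentreOrderFiltration`), the eigen-substitutions `s_μ` as
group automorphisms, and any claim of engine 1's (Φ1) / T107 beyond these identities.
-/

namespace Literature.AlgebraicGeometry.Resolution.WeightedBlowup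

open Polynomial Finset
open scoped Nat

namespace TruncatedFlow

variable {R : Type*} [CommRing R] {ι : Type*} (D : Derivation R (MvPolynomial ι R) (MvPolynomial ι R)) (p : ℕ) (u : ℕ → R)

/-! ## The flow `Ψ_τ` -/

/-- `Ψ_τ` on constants: `g ↦ (T g)(σ := τ)`, an `R`-algebra hom `A →ₐ[R] A[σ]` (construction, ours; the cell's `exp_{<p}(τ𝔇)`
restricted to `A = k[ε]`). [cite: Matsumura1987, §27 (pp. 207–209)] -/
noncomputable def flowC (τ : R[X]) : MvPolynomial ι R →ₐ[R] (MvPolynomial ι R)[X] :=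
  ((aeval (R := MvPolynomial ι R) (τ.map MvPolynomial.C)).restrictScalars R).comp (sigmaExp D p u)

/-- Unfolding (plumbing). [cite: Matsumura1987, §27 (pp. 207–209)] -/
theorem flowC_apply (τ : R[X]) (g : MvPolynomial ι R) : flowC D p u τ g = aeval (τ.map MvPolynomial.C) (sigmaExp D p u g) := rfl

/-- `Ψ_τ` as a substitution of `A[σ]`: `σ ↦ σ`, `C g ↦ flowC τ g` (construction, ours; the cell's `Ψ_τ = exp_{<p}(τ𝔇)`).
[cite: Matsumura1987, §27 (pp. 207–209)] -/
noncomputable def flow (τ : R[X]) : (MvPolynomial ι R)[X] →+* (MvPolynomial ι R)[X] :=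
  eval₂RingHom (flowC D p u τ).toRingHom X

/-- `Ψ_τ σ = σ` (plumbing). [cite: Matsumura1987, §27 (pp. 207–209)] -/
@[simp] theorem flow_X (τ : R[X]) : flow D p u τ X = X := by
  rw [flow, coe_eval₂RingHom, eval₂_X]

/-- `Ψ_τ (C g) = flowC τ g` (plumbing). [cite: Matsumura1987, §27 (pp. 207–209)] -/
theorem flow_C (τ : R[X]) (g : MvPolynomial ι R) : flow D p u τ (C g) = flowC D p u τ g := by
  rw [flow, coe_eval₂RingHom, eval₂_C]; rfl

/-- `Ψ_τ` fixes the scalars `R` (plumbing). [cite: Matsumura1987, §27 (pp. 207–209)] -/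
theorem flowC_C (τ : R[X]) (r : R) : flowC D p u τ (MvPolynomial.C r) = C (MvPolynomial.C r) := by
  rw [flowC_apply, sigmaExp_C, aeval_C, C_eq_algebraMap]

/-- `Ψ_τ` fixes the scalars `R` (plumbing). [cite: Matsumura1987, §27 (pp. 207–209)] -/
theorem flow_C_C (τ : R[X]) (r : R) : flow D p u τ (C (MvPolynomial.C r)) = C (MvPolynomial.C r) := by
  rw [flow_C, flowC_C]

/-- `Ψ_τ` fixes `R[σ] ⊆ A[σ]` (plumbing). [cite: Matsumura1987, §27 (pp. 207–209)] -/
theorem flow_comp_mapRingHom (τ : R[X]) :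
    (flow D p u τ).comp (mapRingHom (MvPolynomial.C : R →+* MvPolynomial ι R)) = mapRingHom MvPolynomial.C :=
  Polynomial.ringHom_ext (fun r => by rw [RingHom.comp_apply, coe_mapRingHom, Polynomial.map_C, flow_C_C])
    (by rw [RingHom.comp_apply, coe_mapRingHom, Polynomial.map_X, flow_X])

/-- `Ψ_τ ⟪f⟫ = ⟪f⟫` for `f ∈ R[σ]` (plumbing). [cite: Matsumura1987, §27 (pp. 207–209)] -/
theorem flow_map (τ f : R[X]) : flow D p u τ (f.map MvPolynomial.C) = (f.map MvPolynomial.C) := by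
  simpa only [RingHom.comp_apply, coe_mapRingHom] using RingHom.congr_fun (flow_comp_mapRingHom D p u τ) f

/-- `Ψ_τ` on a generator: `Ψ_τ ε_i = Σ_{k<p} u_k D^[k](ε_i) ⟪τ⟫^k` (derived here; by definition of `T`).
[cite: Matsumura1987, §27 (pp. 207–209)] -/
theorem flowC_X (τ : R[X]) (i : ι) :
    flowC D p u τ (MvPolynomial.X i) = ∑ k ∈ range p, C (u k • D^[k] (MvPolynomial.X i)) * (τ.map MvPolynomial.C) ^ k := by
  rw [flowC_apply, sigmaExp_X, map_sum]
  refine Finset.sum_congr rfl fun k _ => ?_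
  rw [map_mul, map_pow, aeval_C, aeval_X, ← C_eq_algebraMap]

/-- At the parameter `τ = σ` the flow on constants IS `T` (derived here). [cite: Matsumura1987, §27 (pp. 207–209)] -/
theorem flowC_X_eq (g : MvPolynomial ι R) : flowC D p u X g = sigmaExp D p u g := by
  rw [flowC_apply, Polynomial.map_X, aeval_X_left, AlgHom.coe_id, id_eq]

/-- `Ψ_{aσ}` on constants is `(σ ↦ aσ) ∘ T` (derived here). [cite: SerreLocalFields1979, Ch. II §4 Lemma 1] -/
theorem flowC_C_mul_X (a : R) (g : MvPolynomial ι R) :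
    flowC D p u (C a * X) g = sigmaScale (MvPolynomial.C a) (sigmaExp D p u g) := by
  rw [flowC_apply, Polynomial.map_mul, Polynomial.map_C, Polynomial.map_X]; rfl

/-- `coeff σ^n (Ψ_{aσ} g) = aⁿ · coeff σ^n (T g)` (derived here). [cite: SerreLocalFields1979, Ch. II §4 Lemma 1] -/
theorem coeff_flowC_C_mul_X (a : R) (g : MvPolynomial ι R) (n : ℕ) :
    (flowC D p u (C a * X) g).coeff n = MvPolynomial.C a ^ n * (sigmaExp D p u g).coeff n := by
  rw [flowC_C_mul_X, coeff_sigmaScale]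

/-- **`coeff σ^n (Ψ_{aσ} g) = (aⁿ u_n) · D^[n] g` for `n < p`** (derived here: (S2) of the companion file) — the "order-`n` data"
of `Ψ_{aσ}`. [cite: Matsumura1987, §27 (pp. 207–209)] -/
theorem coeff_flowC_C_mul_X_of_lt (hu : ∀ k < p, (k ! : R) * u k = 1) (a : R) (g : MvPolynomial ι R) {n : ℕ} (hn : n < p) :
    (flowC D p u (C a * X) g).coeff n = (a ^ n * u n) • D^[n] g := by
  rw [coeff_flowC_C_mul_X, coeff_sigmaExp_of_lt D p u hu g hn, ← map_pow, ← smul_smul, MvPolynomial.smul_eq_C_mul _ (a ^ n)]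

/-! ## Truncation: `Ψ_τ ≡ Σ_{n<p} u_n D^n ⟪τ⟫^n (mod σ^p)` -/

/-- `σ ∣ τ ⇒ σ ∣ ⟪τ⟫` (plumbing). [cite: SerreLocalFields1979, Ch. II §4 Lemma 1] -/
theorem X_dvd_map {τ : R[X]} (hτ : X ∣ τ) : (X : (MvPolynomial ι R)[X]) ∣ (τ.map MvPolynomial.C) := by
  simpa only [Polynomial.map_X] using Polynomial.map_dvd (MvPolynomial.C : R →+* MvPolynomial ι R) hτ

/-- `σ^m ∣ τ ⇒ σ^m ∣ ⟪τ⟫` (plumbing). [cite: SerreLocalFields1979, Ch. II §4 Lemma 1] -/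
theorem X_pow_dvd_map {m : ℕ} {τ : R[X]} (hτ : X ^ m ∣ τ) : (X : (MvPolynomial ι R)[X]) ^ m ∣ (τ.map MvPolynomial.C) := by
  simpa only [Polynomial.map_pow, Polynomial.map_X] using Polynomial.map_dvd (MvPolynomial.C : R →+* MvPolynomial ι R) hτ

/-- **Truncation** (derived here): if `σ ∣ τ` then for EVERY `g ∈ A`, `Ψ_τ g ≡ Σ_{n<p} u_n D^[n](g) ⟪τ⟫^n (mod σ^p)` —
below `σ^p` the flow is the truncated exponential series in `τ` (the coefficients `n ≥ p` of `T g`, the carries, only contribute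
`O(σ^p)`).
[cite: Matsumura1987, §27 (pp. 207–209)] -/
theorem X_pow_dvd_flowC_sub (hu : ∀ k < p, (k ! : R) * u k = 1) {τ : R[X]} (hτ : X ∣ τ) (g : MvPolynomial ι R) :
    X ^ p ∣ flowC D p u τ g - ∑ n ∈ range p, C (u n • D^[n] g) * (τ.map MvPolynomial.C) ^ n := by
  have hX := X_dvd_map (ι := ι) hτ
  have hdeg : (sigmaExp D p u g).natDegree < p + ((sigmaExp D p u g).natDegree + 1) := by omega
  rw [flowC_apply, aeval_eq_sum_range' hdeg, Finset.sum_range_add]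
  have h1 : ∑ i ∈ range p, (sigmaExp D p u g).coeff i • (τ.map MvPolynomial.C) ^ i
      = ∑ n ∈ range p, C (u n • D^[n] g) * (τ.map MvPolynomial.C) ^ n :=
    Finset.sum_congr rfl fun i hi => by rw [smul_eq_C_mul, coeff_sigmaExp_of_lt D p u hu g (mem_range.mp hi)]
  rw [h1, add_sub_cancel_left]
  exact Finset.dvd_sum fun j _ => by
    rw [smul_eq_C_mul, pow_add]
    exact ((pow_dvd_pow_of_dvd hX p).mul_right _).mul_left _

/-- **Congruence bookkeeping** (derived here): two substitutions of `A[σ]` which agree on `σ` and on the scalars `R`, and agree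
modulo `σ^m` on the generators `ε_i`, agree modulo `σ^m` on all of `A[σ]`. [cite: SerreLocalFields1979, Ch. II §4 Lemma 1] -/
theorem X_pow_dvd_sub_of_forall_X {Φ₁ Φ₂ : (MvPolynomial ι R)[X] →+* (MvPolynomial ι R)[X]} (m : ℕ) (hX : Φ₁ X = Φ₂ X)
    (hC : ∀ r : R, Φ₁ (C (MvPolynomial.C r)) = Φ₂ (C (MvPolynomial.C r)))
    (hgen : ∀ i, X ^ m ∣ Φ₁ (C (MvPolynomial.X i)) - Φ₂ (C (MvPolynomial.X i))) (y : (MvPolynomial ι R)[X]) :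
    X ^ m ∣ Φ₁ y - Φ₂ y := by
  have hmul : ∀ a b, X ^ m ∣ Φ₁ a - Φ₂ a → X ^ m ∣ Φ₁ b - Φ₂ b → X ^ m ∣ Φ₁ (a * b) - Φ₂ (a * b) :=
    fun a b ha hb => by
      have h : Φ₁ (a * b) - Φ₂ (a * b) = Φ₁ a * (Φ₁ b - Φ₂ b) + (Φ₁ a - Φ₂ a) * Φ₂ b := by rw [map_mul, map_mul]; ring
      rw [h]
      exact dvd_add (hb.mul_left _) (ha.mul_right _)
  have hadd : ∀ a b, X ^ m ∣ Φ₁ a - Φ₂ a → X ^ m ∣ Φ₁ b - Φ₂ b → X ^ m ∣ Φ₁ (a + b) - Φ₂ (a + b) :=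
    fun a b ha hb => by rw [map_add, map_add, add_sub_add_comm]; exact dvd_add ha hb
  have hCg : ∀ g : MvPolynomial ι R, X ^ m ∣ Φ₁ (C g) - Φ₂ (C g) := fun g => by
    induction g using MvPolynomial.induction_on with
    | C r => rw [hC, sub_self]; exact dvd_zero _
    | add a b ha hb => rw [map_add]; exact hadd _ _ ha hb
    | mul_X g i hg => rw [map_mul]; exact hmul _ _ hg (hgen i)
  induction y using Polynomial.induction_on' with
  | add a b ha hb => exact hadd _ _ ha hb
  | monomial n g =>
    rw [← C_mul_X_pow_eq_monomial]
    refine hmul _ _ (hCg g) ?_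
    rw [map_pow, map_pow, hX, sub_self]
    exact dvd_zero _

/-- `σ^m ∣ τ`, `m ≤ p` ⇒ `Ψ_τ g ≡ g (mod σ^m)` on constants (derived here). [cite: Matsumura1987, §27 (pp. 207–209)] -/
theorem X_pow_dvd_flowC_sub_C (hu : ∀ k < p, (k ! : R) * u k = 1) {m : ℕ} (hm : m ≤ p) {τ : R[X]} (hτ : X ^ m ∣ τ)
    (g : MvPolynomial ι R) : X ^ m ∣ flowC D p u τ g - C g := by
  rcases Nat.eq_zero_or_pos m with rfl | hm0
  · rw [pow_zero]; exact one_dvd _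
  have hX1 : X ∣ τ := (dvd_pow_self X hm0.ne').trans hτ
  have hXm := X_pow_dvd_map (ι := ι) hτ
  obtain ⟨p', rfl⟩ : ∃ p', p = p' + 1 := ⟨p - 1, by omega⟩
  have h0 : u 0 = 1 := by simpa using hu 0 (Nat.succ_pos p')
  have h1 : X ^ m ∣ flowC D (p' + 1) u τ g - ∑ n ∈ range (p' + 1), C (u n • D^[n] g) * (τ.map MvPolynomial.C) ^ n :=
    (pow_dvd_pow X hm).trans (X_pow_dvd_flowC_sub D (p' + 1) u hu hX1 g)
  have h2 : X ^ m ∣ ∑ n ∈ range (p' + 1), C (u n • D^[n] g) * (τ.map MvPolynomial.C) ^ n - C g := by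
    rw [Finset.sum_range_succ', h0, one_smul, Function.iterate_zero_apply, pow_zero, mul_one, add_sub_cancel_right]
    exact Finset.dvd_sum fun n _ => by rw [pow_succ]; exact (hXm.mul_left _).mul_left _
  simpa only [sub_add_sub_cancel] using dvd_add h1 h2

/-- **`σ^m ∣ τ`, `m ≤ p` ⇒ `Ψ_τ ≡ id (mod σ^m)`** on all of `A[σ]` (derived here): `Ψ_τ` lies in the level-`m` congruence
subgroup; in particular (`m = 1`, `σ ∣ τ`) it is a unipotent substitution `≡ id (mod σ)`. [cite: Matsumura1987, §27 (pp. 207–209)] -/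
theorem X_pow_dvd_flow_sub_self (hu : ∀ k < p, (k ! : R) * u k = 1) {m : ℕ} (hm : m ≤ p) {τ : R[X]} (hτ : X ^ m ∣ τ)
    (y : (MvPolynomial ι R)[X]) : X ^ m ∣ flow D p u τ y - y :=
  X_pow_dvd_sub_of_forall_X (Φ₁ := flow D p u τ) (Φ₂ := RingHom.id _) m (by rw [flow_X, RingHom.id_apply])
    (fun r => by rw [flow_C_C, RingHom.id_apply])
    (fun i => by rw [flow_C, RingHom.id_apply]; exact X_pow_dvd_flowC_sub_C D p u hu hm hτ _) y

/-! ## The group law modulo `σ^p` -/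

/-- **Group law, core** (derived here): for `σ ∣ τ₁, τ₂` and every `g ∈ A`,
`Ψ_{τ₁} (Ψ_{τ₂} g) ≡ Ψ_{τ₁+τ₂} g (mod σ^p)` — binomial theorem plus `u_{j+k} C(j+k,j) = u_j u_k` (`j + k < p`); the terms
`j + k ≥ p` are `O(σ^p)`.  Matsumura: iterativity of `(D_1^i/i!)` ⟺ `E_{t+t'} = E_{t'} E_t`. [cite: Matsumura1987, §27 (pp. 207–209)] -/
theorem X_pow_dvd_flow_flowC_sub (hu : ∀ k < p, (k ! : R) * u k = 1) {τ₁ τ₂ : R[X]} (h₁ : X ∣ τ₁) (h₂ : X ∣ τ₂)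
    (g : MvPolynomial ι R) : X ^ p ∣ flow D p u τ₁ (flowC D p u τ₂ g) - flowC D p u (τ₁ + τ₂) g := by
  have hX₁ := X_dvd_map (ι := ι) h₁
  have hX₂ := X_dvd_map (ι := ι) h₂
  obtain ⟨f, hf⟩ : ∃ f : ℕ → ℕ → (MvPolynomial ι R)[X],
      ∀ j k, f j k = C ((u j * u k) • D^[j + k] g) * (τ₁.map MvPolynomial.C) ^ j * (τ₂.map MvPolynomial.C) ^ k :=
    ⟨_, fun _ _ => rfl⟩
  -- (1) reduce `Ψ_{τ₂} g` modulo `σ^p` (`Ψ_{τ₁}` preserves `σ^p`-divisibility since `Ψ_{τ₁} σ = σ`)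
  have h1 : X ^ p ∣ flow D p u τ₁ (flowC D p u τ₂ g)
      - flow D p u τ₁ (∑ k ∈ range p, C (u k • D^[k] g) * (τ₂.map MvPolynomial.C) ^ k) := by
    have h := map_dvd (flow D p u τ₁) (X_pow_dvd_flowC_sub D p u hu h₂ g)
    rwa [map_pow, flow_X, map_sub] at h
  -- (2) apply `Ψ_{τ₁}` termwise and reduce each `Ψ_{τ₁} (u_k D^k g)` modulo `σ^p`
  have h2 : X ^ p ∣ flow D p u τ₁ (∑ k ∈ range p, C (u k • D^[k] g) * (τ₂.map MvPolynomial.C) ^ k)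
      - ∑ k ∈ range p, ∑ j ∈ range p, f j k := by
    rw [map_sum, ← Finset.sum_sub_distrib]
    refine Finset.dvd_sum fun k _ => ?_
    have hjk : ∑ j ∈ range p, f j k
        = (∑ j ∈ range p, C (u j • D^[j] (u k • D^[k] g)) * (τ₁.map MvPolynomial.C) ^ j) * (τ₂.map MvPolynomial.C) ^ k := by
      rw [Finset.sum_mul]
      exact Finset.sum_congr rfl fun j _ => by rw [hf, derivation_iterate_map_smul, smul_smul, Function.iterate_add_apply]
    rw [map_mul, map_pow, flow_C, flow_map, hjk, ← sub_mul]
    exact (X_pow_dvd_flowC_sub D p u hu h₁ _).mul_right _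
  -- (3) the terms with `j + k ≥ p` are `O(σ^p)`
  have h3 : X ^ p ∣ ∑ k ∈ range p, ∑ j ∈ range p, f j k - ∑ j ∈ range p, ∑ k ∈ range (p - j), f j k := by
    rw [Finset.sum_comm, ← Finset.sum_sub_distrib]
    refine Finset.dvd_sum fun j _ => ?_
    rw [← Finset.sum_Ico_eq_sub _ (Nat.sub_le p j)]
    refine Finset.dvd_sum fun k hk => ?_
    have hle : p ≤ j + k := by have := (Finset.mem_Ico.mp hk).1; omega
    rw [hf, mul_assoc]
    refine ((pow_dvd_pow X hle).trans ?_).mul_left _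
    rw [pow_add]
    exact mul_dvd_mul (pow_dvd_pow_of_dvd hX₁ j) (pow_dvd_pow_of_dvd hX₂ k)
  -- (4) binomial theorem: the remaining terms are `Σ_{m<p} u_m D^m g (⟪τ₁⟫ + ⟪τ₂⟫)^m`
  have hcast : ∀ n : ℕ, (n : (MvPolynomial ι R)[X]) = C (MvPolynomial.C (n : R)) := fun n => by rw [map_natCast, map_natCast]
  have h4 : ∑ j ∈ range p, ∑ k ∈ range (p - j), f j k
      = ∑ m ∈ range p, C (u m • D^[m] g) * ((τ₁.map MvPolynomial.C) + (τ₂.map MvPolynomial.C)) ^ m := by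
    rw [← Finset.sum_range_diag_flip]
    refine Finset.sum_congr rfl fun m hm => ?_
    rw [add_pow, Finset.mul_sum]
    refine Finset.sum_congr rfl fun j hjm => ?_
    have hm' : m < p := mem_range.mp hm
    have hjm' : j ≤ m := Nat.lt_succ_iff.mp (mem_range.mp hjm)
    have huj := inv_factorial_mul_choose (hu j (by omega)) (hu (m - j) (by omega))
      (by rw [Nat.add_sub_cancel' hjm']; exact hu m hm')
    rw [Nat.add_sub_cancel' hjm'] at huj
    rw [hf, Nat.add_sub_cancel' hjm', ← huj, hcast, ← smul_smul, MvPolynomial.smul_eq_C_mul _ ((m.choose j : ℕ) : R),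
      ← mul_smul_comm, map_mul]
    ring
  -- (5) … which is `Ψ_{τ₁+τ₂} g` modulo `σ^p`
  have h5 : X ^ p ∣ ∑ j ∈ range p, ∑ k ∈ range (p - j), f j k - flowC D p u (τ₁ + τ₂) g := by
    rw [h4, ← Polynomial.map_add]
    exact dvd_sub_comm.mp (X_pow_dvd_flowC_sub D p u hu (dvd_add h₁ h₂) g)
  have key : flow D p u τ₁ (flowC D p u τ₂ g) - flowC D p u (τ₁ + τ₂) g
      = (flow D p u τ₁ (flowC D p u τ₂ g) - flow D p u τ₁ (∑ k ∈ range p, C (u k • D^[k] g) * (τ₂.map MvPolynomial.C) ^ k))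
        + (flow D p u τ₁ (∑ k ∈ range p, C (u k • D^[k] g) * (τ₂.map MvPolynomial.C) ^ k)
            - ∑ k ∈ range p, ∑ j ∈ range p, f j k)
        + (∑ k ∈ range p, ∑ j ∈ range p, f j k - ∑ j ∈ range p, ∑ k ∈ range (p - j), f j k)
        + (∑ j ∈ range p, ∑ k ∈ range (p - j), f j k - flowC D p u (τ₁ + τ₂) g) := by ring
  rw [key]
  exact dvd_add (dvd_add (dvd_add h1 h2) h3) h5

/-- **GROUP LAW MODULO `σ^p`** (derived here): for `σ ∣ τ₁, τ₂` and every `y ∈ A[σ]`,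
`Ψ_{τ₁} (Ψ_{τ₂} y) ≡ Ψ_{τ₁+τ₂} y (mod σ^p)` — `τ ↦ Ψ_τ` is a homomorphism into the substitutions of `A[σ]` modulo the
level-`p` congruence subgroup (the cell's truncated group `𝔄₁/𝔄_p`). [cite: Matsumura1987, §27 (pp. 207–209)] -/
theorem X_pow_dvd_flow_flow_sub (hu : ∀ k < p, (k ! : R) * u k = 1) {τ₁ τ₂ : R[X]} (h₁ : X ∣ τ₁) (h₂ : X ∣ τ₂)
    (y : (MvPolynomial ι R)[X]) : X ^ p ∣ flow D p u τ₁ (flow D p u τ₂ y) - flow D p u (τ₁ + τ₂) y :=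
  X_pow_dvd_sub_of_forall_X (Φ₁ := (flow D p u τ₁).comp (flow D p u τ₂)) (Φ₂ := flow D p u (τ₁ + τ₂)) p
    (by rw [RingHom.comp_apply, flow_X, flow_X, flow_X])
    (fun r => by rw [RingHom.comp_apply, flow_C_C, flow_C_C, flow_C_C])
    (fun i => by rw [RingHom.comp_apply, flow_C, flow_C]; exact X_pow_dvd_flow_flowC_sub D p u hu h₁ h₂ _) y

/-- `Ψ_0 = id` on constants (derived here; needs `1 ≤ p`). [cite: Matsumura1987, §27 (pp. 207–209)] -/
theorem flowC_zero (hu : ∀ k < p, (k ! : R) * u k = 1) (hp : 1 ≤ p) (g : MvPolynomial ι R) : flowC D p u 0 g = C g := by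
  rw [flowC_apply, Polynomial.map_zero, aeval_def, eval₂_at_zero, sigmaExp_coeff_zero D p u hu hp, ← C_eq_algebraMap]

/-- **`Ψ_0 = id`** (derived here; needs `1 ≤ p`). [cite: Matsumura1987, §27 (pp. 207–209)] -/
theorem flow_zero (hu : ∀ k < p, (k ! : R) * u k = 1) (hp : 1 ≤ p) : flow D p u 0 = RingHom.id _ :=
  Polynomial.ringHom_ext (fun g => by rw [flow_C, flowC_zero D p u hu hp, RingHom.id_apply])
    (by rw [flow_X, RingHom.id_apply])

/-- **`Ψ_{−τ}` inverts `Ψ_τ` modulo `σ^p`** (derived here): `Ψ_{−τ} (Ψ_τ y) ≡ y (mod σ^p)`.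
[cite: Matsumura1987, §27 (pp. 207–209)] -/
theorem X_pow_dvd_flow_neg_flow_sub (hu : ∀ k < p, (k ! : R) * u k = 1) (hp : 1 ≤ p) {τ : R[X]} (hτ : X ∣ τ)
    (y : (MvPolynomial ι R)[X]) : X ^ p ∣ flow D p u (-τ) (flow D p u τ y) - y := by
  have h := X_pow_dvd_flow_flow_sub D p u hu (dvd_neg.mpr hτ) hτ y
  rwa [neg_add_cancel, flow_zero D p u hu hp, RingHom.id_apply] at h

/-- … and `Ψ_τ (Ψ_{−τ} y) ≡ y (mod σ^p)` (derived here). [cite: Matsumura1987, §27 (pp. 207–209)] -/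
theorem X_pow_dvd_flow_flow_neg_sub (hu : ∀ k < p, (k ! : R) * u k = 1) (hp : 1 ≤ p) {τ : R[X]} (hτ : X ∣ τ)
    (y : (MvPolynomial ι R)[X]) : X ^ p ∣ flow D p u τ (flow D p u (-τ) y) - y := by
  have h := X_pow_dvd_flow_flow_sub D p u hu hτ (dvd_neg.mpr hτ) y
  rwa [add_neg_cancel, flow_zero D p u hu hp, RingHom.id_apply] at h

/-- **Powers are multiples of the parameter modulo `σ^p`** (derived here): `(Ψ_τ)^N y ≡ Ψ_{N•τ} y (mod σ^p)`.
[cite: Matsumura1987, §27 (pp. 207–209)] -/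
theorem X_pow_dvd_flow_pow_sub (hu : ∀ k < p, (k ! : R) * u k = 1) (hp : 1 ≤ p) {τ : R[X]} (hτ : X ∣ τ) (N : ℕ)
    (y : (MvPolynomial ι R)[X]) : X ^ p ∣ (flow D p u τ ^ N) y - flow D p u (N • τ) y := by
  induction N generalizing y with
  | zero =>
    rw [pow_zero, zero_nsmul, flow_zero D p u hu hp, RingHom.coe_one, id_eq, RingHom.id_apply, sub_self]
    exact dvd_zero _
  | succ N ih =>
    have hN : X ∣ N • τ := by rw [nsmul_eq_mul]; exact dvd_mul_of_dvd_right hτ _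
    have e : (flow D p u τ ^ (N + 1)) y - flow D p u ((N + 1) • τ) y
        = flow D p u τ ((flow D p u τ ^ N) y - flow D p u (N • τ) y)
          + (flow D p u τ (flow D p u (N • τ) y) - flow D p u (τ + N • τ) y) := by
      rw [pow_succ', RingHom.coe_mul, Function.comp_apply, map_sub, succ_nsmul']
      ring
    rw [e]
    refine dvd_add ?_ (X_pow_dvd_flow_flow_sub D p u hu hτ hN _)
    have h := map_dvd (flow D p u τ) (ih y)
    rwa [map_pow, flow_X] at h

/-! ## Rescaling `σ ↦ cσ` acts on the parameter -/

/-- `⟪τ(cσ)⟫ = ⟪τ⟫(cσ)` (plumbing). [cite: SerreLocalFields1979, Ch. II §4 Lemma 1] -/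
theorem map_sigmaScale (c : R) (τ : R[X]) :
    ((sigmaScale c τ).map MvPolynomial.C : (MvPolynomial ι R)[X]) = sigmaScale (MvPolynomial.C c) (τ.map MvPolynomial.C) := by
  rw [sigmaScale_apply, sigmaScale_apply, Polynomial.map_comp, Polynomial.map_mul, Polynomial.map_C, Polynomial.map_X]

/-- `Ψ_{τ(cσ)} g = (σ ↦ cσ) (Ψ_τ g)` on constants (derived here). [cite: SerreLocalFields1979, Ch. II §4 Lemma 1] -/
theorem flowC_sigmaScale (c : R) (τ : R[X]) (g : MvPolynomial ι R) :
    flowC D p u (sigmaScale c τ) g = sigmaScale (MvPolynomial.C c) (flowC D p u τ g) := by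
  rw [flowC_apply, flowC_apply, map_sigmaScale, aeval_algHom, AlgHom.comp_apply]

/-- **Rescaling acts on the parameter** (derived here; exact, no truncation): `(Ψ_τ)_{cσ} = Ψ_{τ(cσ)}`, i.e.
`rescaleHom (C c) (flow τ) = flow (sigmaScale c τ)`. [cite: SerreLocalFields1979, Ch. II §4 Lemma 1] -/
theorem rescaleHom_flow (c : R) (τ : R[X]) :
    rescaleHom (MvPolynomial.C c) (flow D p u τ) = flow D p u (sigmaScale c τ) :=
  Polynomial.ringHom_ext (fun g => by rw [rescaleHom_C, flow_C, flow_C, flowC_sigmaScale]) (by rw [rescaleHom_X, flow_X])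

/-- … for `τ = aσ`: `(Ψ_{aσ})_{cσ} = Ψ_{(ac)σ}` (derived here). [cite: SerreLocalFields1979, Ch. II §4 Lemma 1] -/
theorem rescaleHom_flow_C_mul_X (c a : R) :
    rescaleHom (MvPolynomial.C c) (flow D p u (C a * X)) = flow D p u (C (a * c) * X) := by
  rw [rescaleHom_flow, map_mul, sigmaScale_C, sigmaScale_X, ← mul_assoc, ← map_mul]

/-- **`s_N Ψ ≡ Ψ^N` in the truncated group** (derived here): for `Ψ = Ψ_σ` and `N : ℕ`, the rescaled flow `(Ψ_σ)_{Nσ} = Ψ_{Nσ}`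
agrees with the `N`-th power `Ψ_σ^N` modulo `σ^p`. [cite: Matsumura1987, §27 (pp. 207–209)] -/
theorem X_pow_dvd_rescaleHom_flow_sub_pow (hu : ∀ k < p, (k ! : R) * u k = 1) (hp : 1 ≤ p) (N : ℕ)
    (y : (MvPolynomial ι R)[X]) :
    X ^ p ∣ rescaleHom (MvPolynomial.C (N : R)) (flow D p u X) y - (flow D p u X ^ N) y := by
  have hN : (N • X : R[X]) = C (N : R) * X := by rw [nsmul_eq_mul, map_natCast]
  rw [rescaleHom_flow, sigmaScale_X, ← hN]
  exact dvd_sub_comm.mp (X_pow_dvd_flow_pow_sub D p u hu hp (dvd_refl X) N y)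

/-! ## `Ψ_τ` is graded -/

section Graded

variable {M : Type*} [AddCommGroup M] {w : ι → M} {ρ θ : M}

/-- If `D` lowers `w`-weights by `θ` then `D^[n]` lowers them by `n • θ` (bookkeeping, ours).
[cite: AbramovichTemkinWlodarczyk2024, Thm. 5.3.1 (2)–(3) (p. 1578)] -/
theorem isWeightedHomogeneous_iterate
    (hD : ∀ (a : MvPolynomial ι R) (m : M), MvPolynomial.IsWeightedHomogeneous w a m →
      MvPolynomial.IsWeightedHomogeneous w (D a) (m - θ))
    {a : MvPolynomial ι R} {m : M} (ha : MvPolynomial.IsWeightedHomogeneous w a m) :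
    ∀ n : ℕ, MvPolynomial.IsWeightedHomogeneous w (D^[n] a) (m - n • θ)
  | 0 => by simpa using ha
  | n + 1 => by
    rw [Function.iterate_succ_apply', succ_nsmul, ← sub_sub]
    exact hD _ _ (isWeightedHomogeneous_iterate hD ha n)

/-- **`Ψ_τ` is GRADED** (derived here): if `D` lowers `w`-weights by `θ` and `⟪τ⟫` has total weight `θ` (for `deg σ = ρ`; e.g.
`τ = cσ` and `θ = ρ`), then `flow τ` is a graded substitution of degree `ρ`.
[cite: AbramovichTemkinWlodarczyk2024, Thm. 5.3.1 (2)–(3) (p. 1578)] -/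
theorem isGradedHom_flow
    (hD : ∀ (a : MvPolynomial ι R) (m : M), MvPolynomial.IsWeightedHomogeneous w a m →
      MvPolynomial.IsWeightedHomogeneous w (D a) (m - θ))
    {τ : R[X]} (hτ : IsTW w ρ θ (τ.map MvPolynomial.C)) : IsGradedHom w ρ (flow D p u τ) where
  map_C_C c := by rw [flow_C_C]
  isTW_X := by rw [flow_X]; exact isTW_X
  isTW_CX i := by
    rw [flow_C, flowC_X]
    refine IsTW.sum _ fun k _ => ?_
    have h1 : IsTW w ρ (w i - k • θ) (C (u k • D^[k] (MvPolynomial.X i)) : (MvPolynomial ι R)[X]) :=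
      isTW_C ((MvPolynomial.weightedHomogeneousSubmodule R w _).smul_mem (u k)
        (isWeightedHomogeneous_iterate D hD (MvPolynomial.isWeightedHomogeneous_X R w i) k))
    have h2 := h1.mul (hτ.pow k)
    rwa [sub_add_cancel] at h2

/-- `⟪cσ⟫` has total weight `ρ` (bookkeeping, ours): the hypothesis of `isGradedHom_flow` for `τ = cσ`, `θ = ρ`.
[cite: AbramovichTemkinWlodarczyk2024, Thm. 5.3.1 (2)–(3) (p. 1578)] -/
theorem isTW_map_C_mul_X (c : R) : IsTW w ρ ρ ((C c * X).map MvPolynomial.C) := by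
  have h := (isTW_C (ρ := ρ) (MvPolynomial.isWeightedHomogeneous_C w c)).mul (isTW_X (w := w) (ρ := ρ))
  rw [zero_add] at h
  rwa [Polynomial.map_mul, Polynomial.map_C, Polynomial.map_X]

end Graded

end TruncatedFlow

end Literature.AlgebraicGeometry.Resolution.WeightedBlowup

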